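import Mathlib
import HarnessLib
import Summits.AtomisticToContinuum.FouriersLaw.Theorems.VanishingNoiseTransferNoisyFourierAbelMonotoneAux1

/-!
# One-sided Abel monotonicity of the Green–Kubo pairing of the flip-noisy pinned chain, part 2
# (stub `stub_abelMonotone`, line `abel-kapitza-even-corrector`, crux `VanishingNoiseTransfer.NoisyFourier`,
# stmt-AtomisticToContinuum-11977)

`--supports stmt-AtomisticToContinuum-11977` file (lead c5), part 2 of 2 (part 1, `…NoisyFourierAbelMonotoneAux1`:
twist bound `∫ u·(u∘Π) ≥ −L M₁/(4ε²)`, corrector norm bound `‖u_s‖² ≤ L M₁/(8εs)`, continuity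
`s'²‖u_{s'} − u_s‖² ≤ (s − s')²‖u_s‖²`). Setting as in `…NoisyFourierAbelTransfer`: the pinned anharmonic chain
`𝐏 = pinnedChain ω₂ lam β γ` (parameters `> 0`), `T > 0`, Gibbs measure `μ_T`, flip-noisy equilibrium generator
`L_ε = 𝐏.flipGenerator L T T ε` (`ε > 0`), total current `J = Σ_i j_i`, CLASSICAL Abel correctors
`u ∈ C² ∩ L²(μ_T)`, `L_ε u = s u − J` pointwise (`s > 0`), and the Abel–Green–Kubo pairing `σ_L(s) := ∫ J u dμ_T`
(independent of the corrector chosen, `resolvent_identity` at `s = s'`).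

MAIN RESULT (`abelMonotone`, registered stub `stub_abelMonotone`): there is `C₀` (here `M₁/(4ε²)`, `M₁` the
`L`-uniform half-current second-moment bound `gibbsHalfCurrentSqLe`) such that for all `L ≥ 2`, `0 < a ≤ b` and
correctors `u_a` at `a`, `u_b` at `b`,
  `∫ J u_b dμ_T − ∫ J u_a dμ_T ≥ −C₀ · L · (b − a)`,
i.e. `s ↦ σ_L(s) + C₀ L s` is NON-DECREASING, uniformly in `L`, with NO Kapitza-type input. This is the free half
of the Abel equicontinuity needed by the Moore–Osgood transfer of the line: given the fixed-`s` thermodynamic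
limits it yields `limsup_L σ_L(0⁺)/(L−1) ≤ lim_{s↓0} lim_L σ_L(s)/(L−1)` (the open-chain conductance cannot
exceed the bulk Abel–Green–Kubo conductivity); only the UPPER Abel modulus at `0⁺` remains open.

Proof.
1. TWO-POINT INEQUALITY (`two_point`): by `resolvent_identity`,
   `σ(s') − σ(s) = (s' − s)∫ u·(u'∘Π) = (s' − s)[∫ u·(u∘Π) + ∫ u·(v∘Π)] ≥ −(s'−s)·L M₁/(4ε²) − (s'−s)²‖u‖²/s'`
   (`v = u' − u`; twist bound, Cauchy–Schwarz and the continuity estimate of part 1).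
2. PARTITION (`abelMonotone`): along a uniform partition of `[a,b]` into `n` steps (correctors at the nodes from
   the landed `stub_abelCorrectorExists`, `‖u_s‖² ≤ L M₁/(8εa)`) the quadratic errors sum to `O(1/n)`; let `n → ∞`.

References: Bernardin–Olla 2011 §5 (resolvent, `Π`-symmetric/antisymmetric parts), §3 (entropy bound);
Eckmann–Pillet–Rey-Bellet 1999 §3 (`L* = ΠLΠ`); folklore. No definitions; axioms `propext`, `Classical.choice`,
`Quot.sound` only.
-/

noncomputable section

open MeasureTheory Filter Topology
open scoped BigOperators
open Literature.MathematicalPhysics.KineticTheory.HeatConduction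
open Summit.AtomisticToContinuum.FouriersLaw.Theorems.SuperadditiveResistance.Kubo (memLp_rev rev rev_apply)
open Summit.AtomisticToContinuum.FouriersLaw.Theorems.VanishingNoiseBound (gibbs_flipInvariant)
open Summit.AtomisticToContinuum.FouriersLaw.Theorems.NoisyFourier.FlipCeiling (gibbsHalfCurrentSqLe)
open Summit.AtomisticToContinuum.FouriersLaw.Theorems.OddResponseBound.Negative.OddPairing (sq_integral_mul_le)

namespace Summit.AtomisticToContinuum.FouriersLaw.Cruxes.NoisyFourier.AbelKapitzaEvenCorrector

namespace AbelMonotone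

open AbelTransfer (memLp_totalCurrent corrector_energy_le corrector_flipEnergy_le resolvent_identity
  memLp_patternAverage integral_rev_gibbsMeasure totalCurrent_neg_momentum abs_integral_mul_totalCurrent_le)

section Chain

variable {ω₂ lam β γ : ℝ}

/-- **Two-point inequality.** For classical Abel correctors `u` at `s > 0` and `u'` at `s' ≥ s` with half-current
second moments `≤ M₁`:
`∫ J u' dμ_T − ∫ J u dμ_T ≥ −(s' − s)·L M₁/(4ε²) − (s' − s)² (∫ u²)/s'`
(`resolvent_identity`: the difference is `(s' − s)∫ u·(u'∘Π)`; split `u' = u + v`; twist bound for `u`,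
Cauchy–Schwarz and `corrector_diff_sq_le` for `v`). [cite: BernardinOlla2011, §5] -/
theorem two_point (hω : 0 < ω₂) (hl : 0 < lam) (hβ : 0 < β) (hγ : 0 < γ) {T : ℝ} (hT : 0 < T)
    {ε : ℝ} (hε : 0 < ε) {L : ℕ} {s s' : ℝ} (hs : 0 < s) (hss' : s ≤ s') {u u' : PhaseSpace L → ℝ}
    (huC : ContDiff ℝ 2 u) (hu2 : MemLp u 2 ((pinnedChain ω₂ lam β γ).gibbsMeasure L T))
    (hpde : ∀ x, (pinnedChain ω₂ lam β γ).flipGenerator L T T ε u x =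
      s * u x - ∑ i, (pinnedChain ω₂ lam β γ).bondCurrent L i x)
    (hu'C : ContDiff ℝ 2 u') (hu'2 : MemLp u' 2 ((pinnedChain ω₂ lam β γ).gibbsMeasure L T))
    (hpde' : ∀ x, (pinnedChain ω₂ lam β γ).flipGenerator L T T ε u' x =
      s' * u' x - ∑ i, (pinnedChain ω₂ lam β γ).bondCurrent L i x)
    {M₁ : ℝ} (hM : ∀ k i j : Fin L,
      MemLp (fun x : PhaseSpace L => x.2 k * deriv (pinnedChain ω₂ lam β γ).V (x.1 j - x.1 i)) 2
          ((pinnedChain ω₂ lam β γ).gibbsMeasure L T) ∧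
        ∫ x, (x.2 k * deriv (pinnedChain ω₂ lam β γ).V (x.1 j - x.1 i)) ^ 2
          ∂((pinnedChain ω₂ lam β γ).gibbsMeasure L T) ≤ M₁) :
    -((s' - s) * (L * M₁ / (4 * ε ^ 2))) -
        (s' - s) ^ 2 * (∫ x, u x ^ 2 ∂((pinnedChain ω₂ lam β γ).gibbsMeasure L T)) / s' ≤
      (∫ x, (∑ i, (pinnedChain ω₂ lam β γ).bondCurrent L i x) * u' x
          ∂((pinnedChain ω₂ lam β γ).gibbsMeasure L T)) -
        ∫ x, (∑ i, (pinnedChain ω₂ lam β γ).bondCurrent L i x) * u x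
          ∂((pinnedChain ω₂ lam β γ).gibbsMeasure L T) := by
  set P := pinnedChain ω₂ lam β γ with hP
  set μ := P.gibbsMeasure L T with hμ
  have hs' : 0 < s' := lt_of_lt_of_le hs hss'
  have hJ2 : MemLp (fun x => ∑ i, P.bondCurrent L i x) 2 μ := memLp_totalCurrent hω hl.le hβ.le γ L hT
  have hJodd : ∀ x : PhaseSpace L, (∑ i, P.bondCurrent L i ((x.1, -x.2) : PhaseSpace L)) =
      -∑ i, P.bondCurrent L i x := totalCurrent_neg_momentum P
  -- resolvent identity
  have hres : (∫ x, (∑ i, P.bondCurrent L i x) * u x ∂μ) - ∫ x, (∑ i, P.bondCurrent L i x) * u' x ∂μ =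
      (s - s') * ∫ x, u x * u' (x.1, -x.2) ∂μ :=
    resolvent_identity hω hl hβ hγ hT ε hJ2 hJodd huC hu2 hpde hu'C hu'2 hpde'
  -- split `u' ∘ Π = u ∘ Π + v ∘ Π`
  have hru2 : MemLp (fun x : PhaseSpace L => u (x.1, -x.2)) 2 μ :=
    memLp_rev hω hl.le hβ.le L hT huC.continuous hu2
  have hru'2 : MemLp (fun x : PhaseSpace L => u' (x.1, -x.2)) 2 μ :=
    memLp_rev hω hl.le hβ.le L hT hu'C.continuous hu'2
  have hrv2 : MemLp (fun x : PhaseSpace L => u' (x.1, -x.2) - u (x.1, -x.2)) 2 μ := hru'2.sub hru2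
  have i1 : Integrable (fun x : PhaseSpace L => u x * u (x.1, -x.2)) μ := hu2.integrable_mul hru2
  have i2 : Integrable (fun x : PhaseSpace L => u x * (u' (x.1, -x.2) - u (x.1, -x.2))) μ :=
    hu2.integrable_mul hrv2
  have hsplit : ∫ x, u x * u' (x.1, -x.2) ∂μ =
      (∫ x, u x * u (x.1, -x.2) ∂μ) + ∫ x, u x * (u' (x.1, -x.2) - u (x.1, -x.2)) ∂μ := by
    rw [← integral_add i1 i2]
    exact integral_congr_ae (ae_of_all _ fun x => by ring)
  -- twist bound for `u`
  have htw := corrector_twist_ge hω hl hβ hγ hT hε hs.le huC hu2 hpde hM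
  -- Cauchy–Schwarz for the `v`-term
  set U := ∫ x, u x ^ 2 ∂μ with hU
  set V := ∫ x, (u' x - u x) ^ 2 ∂μ with hV
  set Y := ∫ x, u x * (u' (x.1, -x.2) - u (x.1, -x.2)) ∂μ with hY
  have hU0 : 0 ≤ U := integral_nonneg fun x => sq_nonneg _
  have hV0 : 0 ≤ V := integral_nonneg fun x => sq_nonneg _
  have hCS : Y ^ 2 ≤ U * ∫ x, (u' (x.1, -x.2) - u (x.1, -x.2)) ^ 2 ∂μ := sq_integral_mul_le hu2 hrv2
  have hrev : ∫ x, (u' (x.1, -x.2) - u (x.1, -x.2)) ^ 2 ∂μ = V :=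
    integral_rev_gibbsMeasure P T (fun x => (u' x - u x) ^ 2)
  rw [hrev] at hCS
  have hdiff : s' ^ 2 * V ≤ (s - s') ^ 2 * U :=
    corrector_diff_sq_le hω hl hβ hγ hT hε.le hs' huC hu2 hpde hu'C hu'2 hpde'
  -- `|Y| ≤ (s' - s) U / s'`
  have hYb : |Y| ≤ (s' - s) * U / s' := by
    have hR0 : 0 ≤ (s' - s) * U / s' := div_nonneg (mul_nonneg (by linarith) hU0) hs'.le
    refine abs_le_of_sq_le_sq ?_ hR0
    have h1 : Y ^ 2 * s' ^ 2 ≤ ((s' - s) * U) ^ 2 := by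
      calc Y ^ 2 * s' ^ 2 ≤ U * V * s' ^ 2 := mul_le_mul_of_nonneg_right hCS (sq_nonneg _)
        _ = U * (s' ^ 2 * V) := by ring
        _ ≤ U * ((s - s') ^ 2 * U) := mul_le_mul_of_nonneg_left hdiff hU0
        _ = ((s' - s) * U) ^ 2 := by ring
    rw [div_pow, le_div_iff₀ (by positivity)]
    exact h1
  have hYl : -((s' - s) * U / s') ≤ Y := (abs_le.mp hYb).1
  -- assemble
  have hkey : (∫ x, (∑ i, P.bondCurrent L i x) * u' x ∂μ) - ∫ x, (∑ i, P.bondCurrent L i x) * u x ∂μ =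
      (s' - s) * ((∫ x, u x * u (x.1, -x.2) ∂μ) + Y) := by
    rw [← hsplit]
    linarith
  rw [hkey]
  have hds : 0 ≤ s' - s := by linarith
  have hlow : -(L * M₁ / (4 * ε ^ 2)) - (s' - s) * U / s' ≤ (∫ x, u x * u (x.1, -x.2) ∂μ) + Y := by
    linarith
  calc -((s' - s) * (L * M₁ / (4 * ε ^ 2))) - (s' - s) ^ 2 * U / s'
      = (s' - s) * (-(L * M₁ / (4 * ε ^ 2)) - (s' - s) * U / s') := by ring
    _ ≤ (s' - s) * ((∫ x, u x * u (x.1, -x.2) ∂μ) + Y) := mul_le_mul_of_nonneg_left hlow hds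

/-- **One-sided Abel monotonicity** (nice form of the registered stub): with `C₀ = M₁/(4ε²)` (`M₁` the uniform
half-current moment bound), for all `L ≥ 2`, `0 < a ≤ b` and classical Abel correctors `u_a` at `a`, `u_b` at `b`,
`∫ J u_b dμ_T − ∫ J u_a dμ_T ≥ −C₀ L (b − a)`: the map `s ↦ ∫ J u_s dμ_T + C₀ L s` is non-decreasing, uniformly in
`L` (partition `[a,b]` into `n` steps, correctors at the nodes by `stub_abelCorrectorExists`, `two_point` on each
step with `∫ u_s² ≤ L M₁/(8εa)`, and `n → ∞`). [cite: BernardinOlla2011, §5] -/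
theorem abelMonotone (hω : 0 < ω₂) (hl : 0 < lam) (hβ : 0 < β) (hγ : 0 < γ) {T : ℝ} (hT : 0 < T) {ε : ℝ}
    (hε : 0 < ε) :
    ∃ C₀ : ℝ, 0 ≤ C₀ ∧ ∀ (L : ℕ), 2 ≤ L → ∀ a b : ℝ, 0 < a → a ≤ b → ∀ ua ub : PhaseSpace L → ℝ,
      (ContDiff ℝ 2 ua ∧ MemLp ua 2 ((pinnedChain ω₂ lam β γ).gibbsMeasure L T) ∧
        ∀ x, (pinnedChain ω₂ lam β γ).flipGenerator L T T ε ua x =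
          a * ua x - ∑ i : Fin L, (pinnedChain ω₂ lam β γ).bondCurrent L i x) →
      (ContDiff ℝ 2 ub ∧ MemLp ub 2 ((pinnedChain ω₂ lam β γ).gibbsMeasure L T) ∧
        ∀ x, (pinnedChain ω₂ lam β γ).flipGenerator L T T ε ub x =
          b * ub x - ∑ i : Fin L, (pinnedChain ω₂ lam β γ).bondCurrent L i x) →
      -(C₀ * L * (b - a)) ≤
        (∫ x, (∑ i : Fin L, (pinnedChain ω₂ lam β γ).bondCurrent L i x) * ub x
            ∂((pinnedChain ω₂ lam β γ).gibbsMeasure L T)) -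
          ∫ x, (∑ i : Fin L, (pinnedChain ω₂ lam β γ).bondCurrent L i x) * ua x
            ∂((pinnedChain ω₂ lam β γ).gibbsMeasure L T) := by
  classical
  obtain ⟨M₁, hM₁⟩ := gibbsHalfCurrentSqLe (ω₂ := ω₂) (lam := lam) (β := β) hω hl.le hβ.le γ hT
  have hM₁0 : 0 ≤ M₁ := (integral_nonneg fun x => sq_nonneg _).trans (hM₁ 1 0 0 0).2
  refine ⟨M₁ / (4 * ε ^ 2), by positivity, fun L hL a b ha hab ua ub hua hub => ?_⟩
  obtain ⟨huaC, hua2, huapde⟩ := hua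
  obtain ⟨hubC, hub2, hubpde⟩ := hub
  set P := pinnedChain ω₂ lam β γ with hP
  set μ := P.gibbsMeasure L T with hμ
  have hM : ∀ k i j : Fin L, MemLp (fun x : PhaseSpace L => x.2 k * deriv P.V (x.1 j - x.1 i)) 2 μ ∧
      ∫ x, (x.2 k * deriv P.V (x.1 j - x.1 i)) ^ 2 ∂μ ≤ M₁ := fun k i j => hM₁ L k i j
  -- correctors at every `s > 0` (landed `stub_abelCorrectorExists`), junk `0` for `s ≤ 0`
  have hA2 := stub_abelCorrectorExists ω₂ lam β γ T ε hω hl hβ hγ hT hε L hL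
  set w : ℝ → PhaseSpace L → ℝ := fun s => if h : 0 < s then (hA2 s h).choose else fun _ => 0 with hwdef
  have hw : ∀ s : ℝ, 0 < s → ContDiff ℝ 2 (w s) ∧ MemLp (w s) 2 μ ∧
      ∀ x, P.flipGenerator L T T ε (w s) x = s * w s x - ∑ i : Fin L, P.bondCurrent L i x := by
    intro s hs
    have e : w s = (hA2 s hs).choose := by simp only [hwdef, dif_pos hs]
    rw [e]
    exact (hA2 s hs).choose_spec
  -- the Abel–Green–Kubo pairing along the chosen correctors
  set f : ℝ → ℝ := fun s => ∫ x, (∑ i : Fin L, P.bondCurrent L i x) * w s x ∂μ with hfdef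
  have hJ2 : MemLp (fun x => ∑ i, P.bondCurrent L i x) 2 μ := memLp_totalCurrent hω hl.le hβ.le γ L hT
  have hJodd : ∀ x : PhaseSpace L, (∑ i, P.bondCurrent L i ((x.1, -x.2) : PhaseSpace L)) =
      -∑ i, P.bondCurrent L i x := totalCurrent_neg_momentum P
  -- the pairing does not depend on the corrector: `∫ J ua = f a`, `∫ J ub = f b`
  have hfa : ∫ x, (∑ i : Fin L, P.bondCurrent L i x) * ua x ∂μ = f a := by
    have h := resolvent_identity hω hl hβ hγ hT ε hJ2 hJodd huaC hua2 huapde (hw a ha).1 (hw a ha).2.1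
      (hw a ha).2.2
    rw [sub_self, zero_mul] at h
    simp only [hfdef]
    linarith
  have hb : 0 < b := lt_of_lt_of_le ha hab
  have hfb : ∫ x, (∑ i : Fin L, P.bondCurrent L i x) * ub x ∂μ = f b := by
    have h := resolvent_identity hω hl hβ hγ hT ε hJ2 hJodd hubC hub2 hubpde (hw b hb).1 (hw b hb).2.1
      (hw b hb).2.2
    rw [sub_self, zero_mul] at h
    simp only [hfdef]
    linarith
  rw [hfa, hfb]
  -- constants
  set C : ℝ := (L : ℝ) * M₁ / (4 * ε ^ 2) with hC
  set D : ℝ := (L : ℝ) * M₁ / (8 * ε * a) / a with hD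
  have hD0 : 0 ≤ D := by positivity
  -- two-point step along the chosen correctors, for `a ≤ s ≤ s'`
  have hstep : ∀ s s' : ℝ, a ≤ s → s ≤ s' → -((s' - s) * C) - (s' - s) ^ 2 * D ≤ f s' - f s := by
    intro s s' has hss'
    have hs : 0 < s := lt_of_lt_of_le ha has
    have hs' : 0 < s' := lt_of_lt_of_le hs hss'
    have h2 := two_point hω hl hβ hγ hT hε hs hss' (hw s hs).1 (hw s hs).2.1 (hw s hs).2.2
      (hw s' hs').1 (hw s' hs').2.1 (hw s' hs').2.2 hM
    have hN : ∫ x, w s x ^ 2 ∂μ ≤ L * M₁ / (8 * ε * s) :=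
      corrector_normSq_le hω hl hβ hγ hT hε hs (hw s hs).1 (hw s hs).2.1 (hw s hs).2.2 hM
    have hN' : (∫ x, w s x ^ 2 ∂μ) / s' ≤ D := by
      have h1 : L * M₁ / (8 * ε * s) ≤ L * M₁ / (8 * ε * a) := by
        apply div_le_div_of_nonneg_left (by positivity) (by positivity)
        exact mul_le_mul_of_nonneg_left has (by positivity)
      calc (∫ x, w s x ^ 2 ∂μ) / s' ≤ (L * M₁ / (8 * ε * a)) / s' :=
            div_le_div_of_nonneg_right (hN.trans h1) hs'.le
        _ ≤ (L * M₁ / (8 * ε * a)) / a := by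
            apply div_le_div_of_nonneg_left (by positivity) ha (has.trans hss')
        _ = D := by simp only [hD]
    have hq : (s' - s) ^ 2 * (∫ x, w s x ^ 2 ∂μ) / s' ≤ (s' - s) ^ 2 * D := by
      rw [mul_div_assoc]
      exact mul_le_mul_of_nonneg_left hN' (sq_nonneg _)
    simp only [hfdef] at h2 ⊢
    linarith
  -- telescoping along the uniform partition with `n` steps
  have htel : ∀ n : ℕ, 0 < n → ∀ k : ℕ, k ≤ n →
      -((k : ℝ) * ((b - a) / n) * C) - (k : ℝ) * ((b - a) / n) ^ 2 * D ≤ f (a + k * ((b - a) / n)) - f a := by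
    intro n hn k
    induction k with
    | zero =>
      intro _
      simp
    | succ k ih =>
      intro hk
      have ih' := ih (Nat.le_of_succ_le hk)
      set Δ : ℝ := (b - a) / (n : ℝ) with hΔdef
      have hΔ : 0 ≤ Δ := div_nonneg (by linarith) (Nat.cast_nonneg n)
      have has : a ≤ a + k * Δ := le_add_of_nonneg_right (mul_nonneg (Nat.cast_nonneg k) hΔ)
      have hss' : a + k * Δ ≤ a + ((k : ℝ) + 1) * Δ := by nlinarith
      have hst := hstep _ _ has hss'
      have e : a + ((k : ℝ) + 1) * Δ - (a + k * Δ) = Δ := by ring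
      rw [e] at hst
      push_cast
      calc -(((k : ℝ) + 1) * Δ * C) - ((k : ℝ) + 1) * Δ ^ 2 * D
          = (-((k : ℝ) * Δ * C) - (k : ℝ) * Δ ^ 2 * D) + (-(Δ * C) - Δ ^ 2 * D) := by ring
        _ ≤ (f (a + k * Δ) - f a) + (f (a + ((k : ℝ) + 1) * Δ) - f (a + k * Δ)) := add_le_add ih' hst
        _ = f (a + ((k : ℝ) + 1) * Δ) - f a := by ring
  have hbound : ∀ n : ℕ, 0 < n → -((b - a) * C) - (b - a) ^ 2 * D / n ≤ f b - f a := by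
    intro n hn
    have h := htel n hn n le_rfl
    have hn' : (n : ℝ) ≠ 0 := by exact_mod_cast hn.ne'
    have e1 : a + (n : ℝ) * ((b - a) / n) = b := by field_simp; ring
    have e2 : (n : ℝ) * ((b - a) / n) * C = (b - a) * C := by field_simp
    have e3 : (n : ℝ) * ((b - a) / n) ^ 2 * D = (b - a) ^ 2 * D / n := by field_simp
    rw [e1, e2, e3] at h
    exact h
  -- let `n → ∞`
  have hlim : Tendsto (fun n : ℕ => -((b - a) * C) - (b - a) ^ 2 * D / (n : ℝ)) atTop
      (𝓝 (-((b - a) * C) - 0)) :=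
    tendsto_const_nhds.sub (tendsto_const_div_atTop_nhds_zero_nat ((b - a) ^ 2 * D))
  rw [sub_zero] at hlim
  have hev : ∀ᶠ n : ℕ in atTop, -((b - a) * C) - (b - a) ^ 2 * D / (n : ℝ) ≤ f b - f a := by
    filter_upwards [eventually_gt_atTop 0] with n hn
    exact hbound n hn
  have hmain : -((b - a) * C) ≤ f b - f a := le_of_tendsto hlim hev
  have e : M₁ / (4 * ε ^ 2) * L * (b - a) = (b - a) * C := by
    simp only [hC]
    ring
  rw [e]
  exact hmain

end Chain

end AbelMonotone

/-! ## Registered stub -/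

/-- STUB M — **ONE-SIDED ABEL MONOTONICITY** (line `abel-kapitza-even-corrector`, crux stmt-AtomisticToContinuum-11977,
lead c5): for the flip-noisy pinned chain at equilibrium there is `C₀ ≥ 0` (independent of `L`, `a`, `b`) such
that for all `L ≥ 2`, `0 < a ≤ b` and classical Abel correctors `u_a` at `a`, `u_b` at `b`,
`−C₀ L (b − a) ≤ ∫ J_L u_b dμ_T − ∫ J_L u_a dμ_T`: the Abel–Green–Kubo pairing `s ↦ ∫ J_L u_s dμ_T + C₀ L s` is
non-decreasing, uniformly in `L` (`AbelMonotone.abelMonotone`, notation-free restatement). The `Π`-odd part of a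
corrector is flip-charged and therefore controlled by the flip Dirichlet energy; no Kapitza-type bound enters.
[cite: BernardinOlla2011, §5] -/
theorem stub_abelMonotone :
    ∀ (ω₂ lam β γ T ε : ℝ), 0 < ω₂ → 0 < lam → 0 < β → 0 < γ → 0 < T → 0 < ε → ∃ C₀ : ℝ, 0 ≤ C₀ ∧ ∀ (L : ℕ), 2 ≤ L → ∀ a b : ℝ, 0 < a → a ≤ b → ∀ ua ub : Literature.MathematicalPhysics.KineticTheory.HeatConduction.PhaseSpace L → ℝ, (ContDiff ℝ 2 ua ∧ MeasureTheory.MemLp ua 2 ((Literature.MathematicalPhysics.KineticTheory.HeatConduction.pinnedChain ω₂ lam β γ).gibbsMeasure L T) ∧ ∀ x, (Literature.MathematicalPhysics.KineticTheory.HeatConduction.pinnedChain ω₂ lam β γ).flipGenerator L T T ε ua x = a * ua x - ∑ i : Fin L, (Literature.MathematicalPhysics.KineticTheory.HeatConduction.pinnedChain ω₂ lam β γ).bondCurrent L i x) → (ContDiff ℝ 2 ub ∧ MeasureTheory.MemLp ub 2 ((Literature.MathematicalPhysics.KineticTheory.HeatConduction.pinnedChain ω₂ lam β γ).gibbsMeasure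 L T) ∧ ∀ x, (Literature.MathematicalPhysics.KineticTheory.HeatConduction.pinnedChain ω₂ lam β γ).flipGenerator L T T ε ub x = b * ub x - ∑ i : Fin L, (Literature.MathematicalPhysics.KineticTheory.HeatConduction.pinnedChain ω₂ lam β γ).bondCurrent L i x) → -(C₀ * L * (b - a)) ≤ MeasureTheory.integral ((Literature.MathematicalPhysics.KineticTheory.HeatConduction.pinnedChain ω₂ lam β γ).gibbsMeasure L T) (fun x => (∑ i : Fin L, (Literature.MathematicalPhysics.KineticTheory.HeatConduction.pinnedChain ω₂ lam β γ).bondCurrent L i x) * ub x) - MeasureTheory.integral ((Literature.MathematicalPhysics.KineticTheory.HeatConduction.pinnedChain ω₂ lam β γ).gibbsMeasure L T) (fun x => (∑ i : Fin L, (Literature.MathematicalPhysics.KineticTheory.HeatConduction.pinnedChain ω₂ lam β γ).bondCurrent L i x) * ua x) :=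
  fun _ _ _ _ _ _ hω hl hβ hγ hT hε => AbelMonotone.abelMonotone hω hl hβ hγ hT hε

end Summit.AtomisticToContinuum.FouriersLaw.Cruxes.NoisyFourier.AbelKapitzaEvenCorrector

end
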